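import Summits.BirchSwinnertonDyer.Rank1Residual.Additive.PlusSymbolsPIntegralOfIrreducible
import Literature.NumberTheory.EllipticCurves.CuspFormLFunctionLevelConductorProofs
import Literature.NumberTheory.EllipticCurves.LFunctionPrimeCoeff
import HarnessLib

/-!
# Census H-2(b) / Route-2 input I2 (`PlusSymbolsPIntegralAt W p`): the ONE-PRIME CERTIFICATE
# format `(ℓ ≡ 1 (mod N_W), a_ℓ(W))`, `p ∤ a_ℓ − ℓ − 1`, and its soundness — a Galois-image-free
# road beside `plusSymbolsPIntegralAt_of_irreducible` (cell `b2b-bsdres`, census cell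
# `bsd-formula-census`, seat `b2b-bsdres-census-ctyper1` = conjecture-typer 1, gen 16;
# n1011 route planner 2, ROUTE-2 §II.27, ST-27.3 (ii) "I2 certificates on the 6 receivers")

HONEST FRAMING (cell `b2b-bsdres`, run/shared/lean/b2b/bsd-rank1-residual/, verbatim in every
file): the goal of the cell is to DELETE the COMBINATION-SHAPED residual classes of the
Birch–Swinnerton-Dyer formula for ALL analytic-rank `≤ 1` elliptic curves over `ℚ` — "full BSD
formula for every rank `≤ 1` curve in class `C`" assembled STRICTLY from published theorems — so
that the rank-`≤ 1` remainder becomes exactly the CONSTRUCTION-SHAPED classes, which are TYPED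
(missing-input `Prop`s), NOT attempted. This is not "finishing BSD". Census cell
(bsd-formula-census; lead `cp-bsdcensus`, census-lead, typers `census-ctyper1/2`, referee
`b2b-bsdres-ref-3`): research instrumentation; census output = EVIDENCE / conjecture items for the
kernel cell, never a Literature fact; N10 / X3♯(G-ord) / X4♯(G-ord) stay CONSTRUCTION-SHAPED;
labels / RESIDUAL-MAP marks UNCHANGED; nothing booked. TOOL theorems only (three, bookkeeping on
the tree's modular symbols); no definition, no named fact, no Literature file; every published
input is an explicit binder (here: modularity `exists_isNewformOf`, to pin the level).

## What and why

`PlusSymbolsPIntegralAt W p` (`TameBranchUpper.lean`, cc-typer-2; census H-2(b): the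
`Ω⁺_f`-normalised plus symbols `[x]⁺_f = ratPlusSymbol f x` of the newform `f` of `W` are
`p`-integral at EVERY `x ∈ ℚ`) is Route 2's input **I2** on the six `e346` receivers of
`ROUTE-2.md` §II.27.2 (e) (`46200dg1, 131100f1, 133350bm1, 233450cr1, 423150da1, 499800el1`;
`p = 5`, type `(5; 4)`; ANCHORED-PENDING {I1, I2, T1, T2, T3, F4}); ST-27.3 (ii) asked this seat
for "I2 certificates (plus symbols at the 5-power-denominator cusps) on the 6 receivers".

FIRST, THE POINTER (nothing to run): I2 is ALREADY A TREE THEOREM on every row with irreducible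
`E[p]`, `p` odd — `plusSymbolsPIntegralAt_of_irreducible` / `plusSymbolsPIntegralAt_of_surj` /
`plusSymbolsPIntegralAt_of_classX4` (`PlusSymbolsPIntegralOfIrreducible.lean`, n1011-p09, OWNERS
row T-R18b "JOIN BY NAME"), resting on `norm_ratPlusSymbol_le_one_of_irreducible`
(`PlusSymbolIntegrality.lean`: Drinfeld's operator `T_ℓ − ℓ − 1` at EVERY cusp for a prime
`ℓ ≡ 1 (mod N)`, the Eisenstein multiple `(a_ℓ − ℓ − 1){∞, r}_f ∈ Λ_f` for all `r`
(`sub_mul_modularSymbol_mem_periodLattice_of_one_mod`), and the EXISTENCE of such an `ℓ` with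
`p ∤ a_ℓ − ℓ − 1` from irreducibility, `GaloisImage.exists_prime_one_mod_not_dvd_frobeniusTrace_sub`).
All six receivers are surjective at `5` (Cremona/Sutherland `galrep` records: 46200dg1 `2B`,
131100f1 `—`, 133350bm1 `—`, 233450cr1 `—`, 423150da1 `2B`, 499800el1 `2B`; no `5`-adic entry), so
`plusSymbolsPIntegralAt_of_surj W 5 (by decide) hsurj` discharges I2 on 6/6 given the record binder
`hsurj : W.HasSurjectiveModNGaloisRep 5`. No modular-symbol space at conductor `~10⁵–5·10⁵` is
needed; SIZE of ST-27.3 (ii) = zero.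

SECOND, WHAT THIS FILE ADDS (the "certificate" in the literal sense asked for): the same Drinfeld
argument WITHOUT the Galois-image binder. If ONE prime `ℓ ≡ 1 (mod N)` with `p ∤ a_ℓ(W) − ℓ − 1` is
GIVEN (a record: one point count), then `|[x]⁺_f|_p ≤ 1` for every `x` at once
(`norm_ratPlusSymbol_le_one_of_cert`, level-`N` form, no modularity binder: p09's
`sub_mul_modularSymbol_mem_periodLattice_of_one_mod` + `norm_ratPlusSymbol_le_one_of_forall` with
`n₀ = a_ℓ − ℓ − 1` read off Mathlib's `W.LFunction ℓ = a_ℓ(f)`); and since `PlusSymbolsPIntegralAt`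
quantifies over newforms of `W` at ANY level, the curve-level form pins the level to the conductor
by Carayol's theorem — in the tree a consequence of modularity,
`IsNewformOf.level_eq_conductorNorm_of_exists_isNewformOf` — whence the binder
`hmod : exists_isNewformOf` in `plusSymbolsPIntegralAt_of_cert` /
`plusSymbolsPIntegralAt_of_frobeniusTrace_cert`. So per row the I2 input is EITHER the galrep
record `surj(5)` (p09's road, no modularity binder) OR one Frobenius trace `a_ℓ` at a prime
`ℓ ≡ 1 (mod N_W)` plus modularity (this road). Neither road computes a modular symbol.

## SCOPE (gen 17): an IRREDUCIBLE-row (X4) road — VACUOUS on the Eisenstein-additive rows X3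

On a row with `E[p]` REDUCIBLE and `W` ADDITIVE at `p` (`ClassX3 W p = Red W p ∧ Addv W p`, the
census's typeG rows with a rational `p`-isogeny) NO certificate prime exists, so `hcert` below is
unsatisfiable and this file feeds nothing there. Reason (elementary, NOT a tree theorem — the
conductor-EXPONENT comparison it uses is not in the tree; the prime-SUPPORT half is,
`Literature/…/IsogenyCharacterCongruenceSieve.lean`): let `r : Γ_ℚ → 𝔽_pˣ` be the character of a
`Γ_ℚ`-stable line in `E[p]`; then `a_ℓ ≡ r(φ_ℓ) + ℓ·r(φ_ℓ)⁻¹ (mod p)` at every good `ℓ ∤ pN_W`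
(Mazur 1978, Prop. 6.3 (1)); `r` has order dividing `p − 1`, so it is tame at `p` (conductor
exponent `≤ 1 < 2 ≤ v_p(N_W)` at an additive `p`), and at each `q ≠ p` its conductor exponent is at
most that of `W` (`a_q(r) + a_q(ρ̄/r) ≤ a_q(ρ̄_{E,p}) ≤ a_q(ρ_{E,p}) = v_q(N_W)`: invariants grow
under reduction and in extensions, Swan parts agree / add); hence `cond(r) ∣ N_W`, so
`r(φ_ℓ) = 1` whenever `N_W ∣ ℓ − 1`, and then **`a_ℓ(W) ≡ 1 + ℓ ≡ 2 (mod p)` at EVERY prime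
`ℓ ≡ 1 (mod N_W)`**. Numerically, on the whole census universe (census-ctyper1 gen 17, stdlib
point counts on Cremona's models, `HOME/b2b-bsdres-census-ctyper1/x3vac/`; W1's 216 typeG rows
`X43-W1-CERTTABLE-N3000.tsv` 96c9e78d7afe2f7b, `N ≤ 3000`, `p ∈ {5, 7, 13}`; the first four primes
`ℓ ≡ 1 (mod N_W)` per row): the 17 rows with a rational `p`-isogeny have residue
`a_ℓ − ℓ − 1 ≡ 0 (mod p)` on 68/68 primes (forced, as above); the 199 irreducible rows carry a
certificate prime among those four on 199/199 (113/796 residues vanish — density, not forced). So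
on typeG rows "certifiable by one Frobenius trace" = "irreducible `E[p]`" exactly, 216/216. (The
same congruence holds on a reducible row that is good or multiplicative at `p`: there
`r|_{I_p} ∈ {1, ω}` (ordinary or Tate shape `(ω ∗; 0 1)` on inertia; supersingular `E[p]` is
irreducible already on `I_p`), so `r = ω^a·ψ` with `a ∈ {0, 1}`, `ψ` unramified at `p`,
`cond(ψ) ∣ N_W`, and `a_ℓ ≡ ℓ^a + ℓ^{1−a} = ℓ + 1 (mod p)` — checked on 11a1–3@5, 14a1/a4@3,
19a1@3, 20a1@3, 26b1@7, 37b1@3, 38b1@5, 66c1@5, five primes each, 55/55 residues zero; so the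
certificate road is vacuous on EVERY row with reducible `E[p]`, additive at `p` or not.)

And the PREDICATE ITSELF on X3 rows is a genuine per-pair datum, false on a named sub-family —
census X4-3 W1 (`ttrl/bsd-formula-census/X43-W1-CERTTABLE.md` §3; 216 typeG rows, `p ∈ {5,7,13}`):
of the 17 rows whose class has a rational `p`-isogeny, the plus symbols have `v_p(Λ⁺_E) = −1`
(I2 FAILS; the reading of `TameBranchUpper.lean`'s docstring, "fails exactly on the `p`-isogeny
rows") on the 6 rows with image `5B.4.2` / `7B.1.4` (294a1@7, 450a1@5, 490f1@7, 1200q1@5,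
1575k1@5, 2800be1@5) and are `p`-integral (`δ₁ = 0`, `v_p(Λ⁺_E) = 0`) on the 11 rows with images
`5B.1.2` / `5B.1.3` / `7B.1.3` / `7B.6.3` (150a1, 150b1, 175c1, 550k1, 2175j1, 2350e1, 2350n1 @5;
294b1, 490k1, 882c1, 2450j1 @7). So
on X3 rows `PlusSymbolsPIntegralAt W p` has NO kernel feeder today (p09's road needs `Irr W p`;
this road is vacuous), and a consumer carrying `hPI : PlusSymbolsPIntegralAt W p` on an X3♯ row
(e.g. the `SubGord` join `cycLeadingTermAt_of_tameBranchRatDvdAt_of_ordinaryTwistPartnerAt_of_…`,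
`TameBranchUpperOfRatDvdJoin.lean`) holds there an OPEN per-pair binder, unsatisfiable on the
`5B.4.2` / `7B.1.4` rows; the X3 road has to carry the Eisenstein denominator explicitly (route
planner 2 / cc-typer-2 wording; this seat restates nothing). Labels / marks UNCHANGED.

## EVIDENCE (census-ctyper1 gen 16, 2026-08-21; two independent pure-python engines + a PARI
cross-check job; records `HOME/b2b-bsdres-census-ctyper1/i2cert/`): certificate primes for the
six receivers, `p = 5`

| receiver `W` | `N_W` | `ℓ` prime, `N_W ∣ ℓ − 1` | `a_ℓ(W)` | `a_ℓ − ℓ − 1 (mod 5)` |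
|---|---|---|---|---|
| 46200dg1  | 46200  | 92401   | −270  | 3 |
| 131100f1  | 131100 | 131101  | 65    | 3 |
| 133350bm1 | 133350 | 266701  | −50   | 3 |
| 233450cr1 | 233450 | 1167251 | 316   | 4 |
| 423150da1 | 423150 | 3385201 | −2210 | 3 |
| 499800el1 | 499800 | 499801  | 10    | 3 |

(engine 1: point count `a_ℓ = ℓ + 1 − #Ẽ(𝔽_ℓ)` by Euler's criterion on Cremona's minimal model,
deterministic Miller–Rabin for `ℓ`; engine 1b, independent arithmetic: point count by the binary
Jacobi-reciprocity symbol on the short model `Y² = X³ − 27c₄X − 54c₆`, trial-division primality —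
18/18 candidate `(W, ℓ)` rows identical (three candidates per receiver); a PARI `ellap` /
`ellglobalred` cross-check is filed as kit job `j136790`, its log joins the records. The smallest
candidate fails on 133350bm1 — `ℓ = 133351`, `a_ℓ = 377 ≡ 2 (mod 5)` — any ONE good `ℓ` suffices;
since `25 ∣ N_W`, `ℓ ≡ 1 (mod 5)` and the test is `a_ℓ ≢ 2 (mod 5)`.) Fed to
`plusSymbolsPIntegralAt_of_frobeniusTrace_cert` as the record binders `hℓ1`, `hgood`, `hcert`: I2
on 6/6 modulo `hmod`. The receivers' ANCHORED-PENDING status is the route planner's and the n1011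
lead's to restate — this file moves no mark, closes nothing, and does not touch `surj(5)`.

## Main statements (sorry-free; standard axioms)

* `CensusX43.norm_ratPlusSymbol_le_one_of_cert` : `f` the newform of `W` at level `N`, `p` odd,
  `ℓ` prime, `N ∣ ℓ − 1`, `p ∤ a_ℓ(W) − ℓ − 1` ⟹ `∀ x, |[x]⁺_f|_p ≤ 1`;
* `CensusX43.plusSymbolsPIntegralAt_of_cert` : under `exists_isNewformOf`, a certificate prime
  `ℓ ≡ 1 (mod N_W)` with `p ∤ W.LFunction ℓ − ℓ − 1` ⟹ `PlusSymbolsPIntegralAt W p`;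
* `CensusX43.plusSymbolsPIntegralAt_of_frobeniusTrace_cert` : the same read on the tree's
  `W.frobeniusTrace ℓ` at a good `ℓ` (the shape of the census record `(ℓ, a_ℓ)`).

References: Manin 1972, Thm. 3.3 (20), Thm. 3.5 (22) [Manin1972]; Drinfeld 1973; Cremona 1997,
§2.8 (2.8.8) [CremonaAlgorithms1997]; Mazur–Tate–Teitelbaum 1986, §I.4 (4.2), §I.8
[MazurTateTeitelbaum1986Invent]; Wuthrich 2014 p. 382 [Wuthrich2014]; `PlusSymbolIntegrality.lean`,
`PlusSymbolsPIntegralOfIrreducible.lean` (n1011-p09, T-R18b); HOME/cells/n1011/ROUTE-2.md §II.27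
(ST-27.3 (ii)); census-ctyper1 README GEN 16.
-/

noncomputable section

open scoped MatrixGroups ModularForm

open CongruenceSubgroup WeierstrassCurve Literature.NumberTheory.EllipticCurves
  Literature.NumberTheory.EllipticCurves.ModularForms

namespace Summit.BirchSwinnertonDyer.Rank1Residual.Additive

namespace CensusX43

variable {W : WeierstrassCurve ℚ} {N : ℕ} [NeZero N] {f : CuspForm (Gamma0 N) 2}
  {p : ℕ} [Fact p.Prime]

/-- **`p`-integrality of ALL plus symbols of the newform of `W` from ONE certificate prime**
(level-`N` form, no modularity and no Galois-image binder): if `f ∈ S₂(Γ₀(N))` is the newform of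
`W` (`a_n(f) = a_n(W)`, the coefficients of Mathlib's `W.LFunction`), `p` is odd, and `ℓ` is a prime
with `N ∣ ℓ − 1` and `p ∤ a_ℓ(W) − ℓ − 1`, then `|[x]⁺_f|_p ≤ 1` for every `x ∈ ℚ`: the Eisenstein
multiple `(a_ℓ − ℓ − 1){∞, y}_f ∈ Λ_f` at EVERY `y` (`sub_mul_modularSymbol_mem_periodLattice_of_one_mod`,
Drinfeld's `T_ℓ − ℓ − 1`, Manin 1972 Thm. 3.3 (20)) and `norm_ratPlusSymbol_le_one_of_forall`.
[cite: Manin1972, Thm. 3.3 (20) and Thm. 3.5 (22)] -/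
theorem norm_ratPlusSymbol_le_one_of_cert (hf : IsNewformOf W f) (hp2 : p ≠ 2) {ℓ : ℕ}
    (hℓ : ℓ.Prime) (hℓ1 : N ∣ ℓ - 1) (hcert : ¬ (p : ℤ) ∣ W.LFunction ℓ - (ℓ + 1)) (x : ℚ) :
    ‖((ratPlusSymbol f x : ℚ) : ℚ_[p])‖ ≤ 1 := by
  refine norm_ratPlusSymbol_le_one_of_forall f hp2 hcert (fun y ↦ ?_) x
  have h := sub_mul_modularSymbol_mem_periodLattice_of_one_mod hf.1 hℓ hℓ1 y
  rw [hf.2 ℓ] at h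
  push_cast
  convert h using 2
  ring

/-- **Route-2 input I2 from a one-prime certificate** (census H-2(b) at EVERY cusp; the literal
"I2 certificate" of ROUTE-2 ST-27.3 (ii)): under modularity (`hmod : exists_isNewformOf`, which pins
the level of every newform of `W` to the conductor `N_W`:
`IsNewformOf.level_eq_conductorNorm_of_exists_isNewformOf`), if `p` is odd and ONE prime `ℓ` with
`N_W ∣ ℓ − 1` has `p ∤ a_ℓ(W) − ℓ − 1` (`a_ℓ(W) = W.LFunction ℓ`), then `PlusSymbolsPIntegralAt W p`.
Companion (Galois-image road, no modularity binder): `plusSymbolsPIntegralAt_of_irreducible`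
(n1011-p09). TOOL theorem; closes nothing; the receivers' status is the route planner's to restate.
[cite: Manin1972, Thm. 3.3 (20) and Thm. 3.5 (22)]
[cite: CremonaAlgorithms1997, §2.8 (2.8.8) (PDF p. 26)] -/
theorem plusSymbolsPIntegralAt_of_cert [W.IsElliptic] (hmod : exists_isNewformOf) (hp2 : p ≠ 2)
    {ℓ : ℕ} (hℓ : ℓ.Prime) (hℓ1 : W.conductorNorm ℤ ∣ ℓ - 1)
    (hcert : ¬ (p : ℤ) ∣ W.LFunction ℓ - (ℓ + 1)) : PlusSymbolsPIntegralAt W p := by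
  intro N _ f hf x
  have hN : N = W.conductorNorm ℤ := hf.level_eq_conductorNorm_of_exists_isNewformOf hmod
  subst hN
  exact norm_ratPlusSymbol_le_one_of_cert hf hp2 hℓ hℓ1 hcert x

/-- **I2 from a one-prime certificate, Frobenius-trace form** — the shape of the census record
`(ℓ, a_ℓ)`: the same with the certificate read on the tree's
`a_ℓ(W) = W.frobeniusTrace ℓ = ℓ + 1 − #Ẽ(𝔽_ℓ)` (globally minimal model) at a prime `ℓ` of good
reduction with `N_W ∣ ℓ − 1`, via `W.LFunction ℓ = W.frobeniusTrace ℓ`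
(`WeierstrassCurve.LFunction_apply_prime_eq_frobeniusTrace`, Silverman AEC Exercise 8.19(a)).
EVIDENCE: certificate primes for the six Route-2 receivers at `p = 5` in the module docstring
(two independent engines). [cite: Manin1972, Thm. 3.3 (20) and Thm. 3.5 (22)]
[cite: SilvermanAEC2009, Exercise 8.19(a) (p. 230) and §C.16 (PDF p. 390)] -/
theorem plusSymbolsPIntegralAt_of_frobeniusTrace_cert [W.IsElliptic] [W.IsGloballyMinimal]
    (hmod : exists_isNewformOf) (hp2 : p ≠ 2) {ℓ : ℕ} [hℓ : Fact ℓ.Prime]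
    (hℓ1 : W.conductorNorm ℤ ∣ ℓ - 1) (hgood : W.HasGoodReductionAtPrime ℓ)
    (hcert : ¬ (p : ℤ) ∣ W.frobeniusTrace ℓ - (ℓ + 1)) : PlusSymbolsPIntegralAt W p := by
  refine plusSymbolsPIntegralAt_of_cert hmod hp2 hℓ.out hℓ1 ?_
  rwa [WeierstrassCurve.LFunction_apply_prime_eq_frobeniusTrace W ℓ hgood]

end CensusX43

end Summit.BirchSwinnertonDyer.Rank1Residual.Additive

end
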